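import Mathlib
import Literature.Analysis.FluidPDE.VectorCalculus
import Literature.Analysis.FluidPDE.IsometryInvariance
import Summits.NavierStokesRegularity.NavierStokesRegularity.Theorems.PlaneEnergyCeilingSlabEnergyIdentitySlab
import Summits.NavierStokesRegularity.NavierStokesRegularity.Theorems.PlaneEnergyCeilingSlabEnergyIdentityPointwise

/-!
# Route PlaneEnergyCeiling · crux `PlanarEnergyAPriori` — no net flux through a plane

Helper file for the crux item stmt-NavierStokesRegularity-16855 (`PlanarEnergyAPriori`, route
`PlaneEnergyCeiling`), landed `--supports` that item; shared by the signed flux ledger (it removes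
the pressure constant `π₀(s)` from the smoothed Bernoulli flux) and by the mild slab law (it makes
the oscillation `osc_c F(s,·)` of the Bernoulli flux independent of the pressure normalisation).

**Statement** (`integral_plane_apply_two_eq_zero`). For a `C¹` divergence-free field `u` on `ℝ³`
with `‖u(x)‖, ‖Du(x)‖ ≤ C (1+‖x‖)⁻³`, the flux of `u` through every coordinate plane vanishes:
`∫_{ℝ²} u₂(y₀, y₁, c) dy = 0` for every `c`; `integral_plane_inner_isometry_eq_zero` is the same
for every plane `R({x₂ = c})`, `R` a linear isometry (flux `∫ ⟪u, R e₂⟫`).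

**Proof.** `Q(c) = ∫ u₂(·,·,c)` is differentiable with `Q'(c) = ∫ ∂₂u₂` (dominated
differentiation under the integral, majorant `C(1+‖y‖)⁻³ ∈ L¹(ℝ²)`), and
`∂₂u₂ = −∂₀u₀ − ∂₁u₁` integrates to zero over the plane (whole-plane integration by parts,
`integral_eq_zero_of_hasLineDerivAt`), so `Q` is constant; and `Q(c) → 0` as `c → +∞` by dominated
convergence (`‖u(y₀,y₁,c)‖ ≤ C(1+|c|)⁻³`). The rotated statement applies this to the conjugate
field `R⁻¹ ∘ u ∘ R` (accepted `IsometryInvariance`). Folklore.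
-/

noncomputable section

-- single-conjunct summit: `Summit.<Summit>.<Problem>` repeats the name by the D-0017 layout
set_option linter.dupNamespace false

namespace Summit.NavierStokesRegularity.NavierStokesRegularity.Theorems.PlanarEnergyAPriori

open MeasureTheory Set Filter Topology Function WithLp Metric
open scoped ENNReal RealInnerProductSpace
open Literature.Analysis.FluidPDE
open Summit.NavierStokesRegularity.NavierStokesRegularity.Theorems.PlaneEnergyCeilingSlabEnergyIdentity

/-! ### Plane bookkeeping -/

/-- `|c| ≤ ‖(y₀, y₁, c)‖`. -/
theorem abs_le_norm_toLp_vec3 (y : EuclideanSpace ℝ (Fin 2)) (c : ℝ) :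
    |c| ≤ ‖(toLp 2 ![y 0, y 1, c] : EuclideanSpace ℝ (Fin 3))‖ := by
  have := norm_apply_le_norm (toLp 2 ![y 0, y 1, c] : EuclideanSpace ℝ (Fin 3)) 2
  simpa [Real.norm_eq_abs] using this

/-- A continuous `g` on `ℝ³` with `‖g x‖ ≤ C (1 + ‖x‖)⁻ʳ`, `r > 2`, is integrable on every plane
`{x₂ = c}` (`‖y‖ ≤ ‖(y₀,y₁,c)‖`, Mathlib `integrable_one_add_norm` in `ℝ²`). -/
theorem integrable_plane_of_norm_le_rpow {F : Type*} [NormedAddCommGroup F] {g : EuclideanSpace ℝ (Fin 3) → F}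
    (hg : Continuous g) {C r : ℝ} (hr : 2 < r) (h : ∀ x, ‖g x‖ ≤ C * (1 + ‖x‖) ^ (-r)) (c : ℝ) :
    Integrable fun y : EuclideanSpace ℝ (Fin 2) => g (toLp 2 ![y 0, y 1, c]) := by
  have hC : 0 ≤ C := by
    have h0 := h 0
    have hw : 0 < (1 + ‖(0 : EuclideanSpace ℝ (Fin 3))‖) ^ (-r) := Real.rpow_pos_of_pos (by positivity) _
    nlinarith [norm_nonneg (g 0)]
  have hr' : (Module.finrank ℝ (EuclideanSpace ℝ (Fin 2)) : ℝ) < r := by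
    rw [finrank_euclideanSpace, Fintype.card_fin]; exact_mod_cast hr
  refine Integrable.mono' ((integrable_one_add_norm hr').const_mul C)
    (hg.comp (continuous_toLp_vec3_left c)).aestronglyMeasurable (Eventually.of_forall fun y => ?_)
  calc ‖g (toLp 2 ![y 0, y 1, c])‖ ≤ C * (1 + ‖(toLp 2 ![y 0, y 1, c] : EuclideanSpace ℝ (Fin 3))‖) ^ (-r) := h _
    _ ≤ C * (1 + ‖y‖) ^ (-r) := by
        gcongr C * ?_
        exact Real.rpow_le_rpow_of_nonpos (by positivity) (by linarith [norm_le_norm_toLp_vec3 y c]) (by linarith)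

/-! ### The planar flux -/

section Flux

variable {u : EuclideanSpace ℝ (Fin 3) → EuclideanSpace ℝ (Fin 3)} {C : ℝ}

/-- **The planar flux is differentiable in the offset**, with derivative the planar integral of
`(∂₂u)₂`: for `C¹` `u` with `‖u‖, ‖Du‖ ≤ C(1+‖x‖)⁻³`. -/
theorem hasDerivAt_planarFlux (hu : ContDiff ℝ 1 u)
    (h0 : ∀ x, ‖u x‖ ≤ C * (1 + ‖x‖) ^ (-(3 : ℝ))) (h1 : ∀ x, ‖fderiv ℝ u x‖ ≤ C * (1 + ‖x‖) ^ (-(3 : ℝ)))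
    (c : ℝ) :
    HasDerivAt (fun c => ∫ y : EuclideanSpace ℝ (Fin 2), u (toLp 2 ![y 0, y 1, c]) 2)
      (∫ y : EuclideanSpace ℝ (Fin 2), fderiv ℝ u (toLp 2 ![y 0, y 1, c]) (EuclideanSpace.single 2 1) 2) c := by
  have hC : 0 ≤ C := by
    have := h0 0
    have hw : 0 < (1 + ‖(0 : EuclideanSpace ℝ (Fin 3))‖) ^ (-(3 : ℝ)) := Real.rpow_pos_of_pos (by positivity) _
    nlinarith [norm_nonneg (u 0)]
  have hdiff : Differentiable ℝ u := hu.differentiable one_ne_zero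
  have hcont : Continuous u := hu.continuous
  have hDcont : Continuous (fderiv ℝ u) := hu.continuous_fderiv one_ne_zero
  -- the integrand, its derivative and the majorant
  have hF_meas : ∀ c' : ℝ, AEStronglyMeasurable
      (fun y : EuclideanSpace ℝ (Fin 2) => u (toLp 2 ![y 0, y 1, c']) 2) volume := fun c' =>
    ((EuclideanSpace.proj (2 : Fin 3)).continuous.comp (hcont.comp (continuous_toLp_vec3_left c'))).aestronglyMeasurable
  have hF_int : Integrable (fun y : EuclideanSpace ℝ (Fin 2) => u (toLp 2 ![y 0, y 1, c]) 2) :=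
    integrable_plane_of_norm_le_rpow (g := fun x => u x 2) ((EuclideanSpace.proj (2 : Fin 3)).continuous.comp hcont)
      (by norm_num : (2 : ℝ) < 3) (fun x => (norm_apply_le_norm (u x) 2).trans (h0 x)) c
  have hF'_meas : AEStronglyMeasurable (fun y : EuclideanSpace ℝ (Fin 2) =>
      fderiv ℝ u (toLp 2 ![y 0, y 1, c]) (EuclideanSpace.single 2 1) 2) volume :=
    ((EuclideanSpace.proj (2 : Fin 3)).continuous.comp
      ((hDcont.comp (continuous_toLp_vec3_left c)).clm_apply continuous_const)).aestronglyMeasurable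
  have hr' : (Module.finrank ℝ (EuclideanSpace ℝ (Fin 2)) : ℝ) < 3 := by
    rw [finrank_euclideanSpace, Fintype.card_fin]; norm_num
  have hbound_int : Integrable fun y : EuclideanSpace ℝ (Fin 2) => C * (1 + ‖y‖) ^ (-(3 : ℝ)) :=
    (integrable_one_add_norm hr').const_mul C
  have h_bound : ∀ᵐ y : EuclideanSpace ℝ (Fin 2), ∀ c' ∈ (univ : Set ℝ),
      ‖fderiv ℝ u (toLp 2 ![y 0, y 1, c']) (EuclideanSpace.single 2 1) 2‖ ≤ C * (1 + ‖y‖) ^ (-(3 : ℝ)) := by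
    refine ae_of_all _ fun y c' _ => ?_
    calc ‖fderiv ℝ u (toLp 2 ![y 0, y 1, c']) (EuclideanSpace.single 2 1) 2‖
        ≤ ‖fderiv ℝ u (toLp 2 ![y 0, y 1, c']) (EuclideanSpace.single 2 1)‖ := norm_apply_le_norm _ 2
      _ ≤ ‖fderiv ℝ u (toLp 2 ![y 0, y 1, c'])‖ := norm_fderiv_single_le u _ 2
      _ ≤ C * (1 + ‖(toLp 2 ![y 0, y 1, c'] : EuclideanSpace ℝ (Fin 3))‖) ^ (-(3 : ℝ)) := h1 _
      _ ≤ C * (1 + ‖y‖) ^ (-(3 : ℝ)) := by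
          gcongr C * ?_
          exact Real.rpow_le_rpow_of_nonpos (by positivity) (by linarith [norm_le_norm_toLp_vec3 y c']) (by norm_num)
  have h_diff : ∀ᵐ y : EuclideanSpace ℝ (Fin 2), ∀ c' ∈ (univ : Set ℝ),
      HasDerivAt (fun c => u (toLp 2 ![y 0, y 1, c]) 2)
        (fderiv ℝ u (toLp 2 ![y 0, y 1, c']) (EuclideanSpace.single 2 1) 2) c' := by
    refine ae_of_all _ fun y c' _ => ?_
    have h1' := ((hdiff _).hasFDerivAt).comp_hasDerivAt c' (hasDerivAt_toLp_vec3 y c')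
    exact ((EuclideanSpace.proj (2 : Fin 3)).hasFDerivAt).comp_hasDerivAt c' h1'
  exact (hasDerivAt_integral_of_dominated_loc_of_deriv_le (univ_mem) (Eventually.of_forall hF_meas) hF_int
    hF'_meas h_bound hbound_int h_diff).2

/-- **In-plane divergences integrate to zero.** For `C¹` `u` with `‖u‖, ‖Du‖ ≤ C(1+‖x‖)⁻³` and an
in-plane direction `j ∈ {0, 1}`: `∫_{ℝ²} (∂ⱼu)ⱼ(y₀,y₁,c) dy = 0` (whole-plane integration by parts). -/
theorem integral_plane_fderiv_apply_inplane_eq_zero (hu : ContDiff ℝ 1 u)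
    (h0 : ∀ x, ‖u x‖ ≤ C * (1 + ‖x‖) ^ (-(3 : ℝ))) (h1 : ∀ x, ‖fderiv ℝ u x‖ ≤ C * (1 + ‖x‖) ^ (-(3 : ℝ)))
    (c : ℝ) {j : Fin 3} {v : EuclideanSpace ℝ (Fin 2)}
    (hv : ∀ (y : EuclideanSpace ℝ (Fin 2)) (t : ℝ),
      (toLp 2 ![(y + t • v : EuclideanSpace ℝ (Fin 2)) 0, (y + t • v : EuclideanSpace ℝ (Fin 2)) 1, c]
        : EuclideanSpace ℝ (Fin 3)) = toLp 2 ![y 0, y 1, c] + t • EuclideanSpace.single j 1) :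
    ∫ y : EuclideanSpace ℝ (Fin 2), fderiv ℝ u (toLp 2 ![y 0, y 1, c]) (EuclideanSpace.single j 1) j = 0 := by
  have hdiff : Differentiable ℝ u := hu.differentiable one_ne_zero
  have hcont : Continuous u := hu.continuous
  have hDcont : Continuous (fderiv ℝ u) := hu.continuous_fderiv one_ne_zero
  have hψ : Integrable fun y : EuclideanSpace ℝ (Fin 2) => u (toLp 2 ![y 0, y 1, c]) j :=
    integrable_plane_of_norm_le_rpow (g := fun x => u x j) ((EuclideanSpace.proj j).continuous.comp hcont)
      (by norm_num : (2 : ℝ) < 3) (fun x => (norm_apply_le_norm (u x) j).trans (h0 x)) c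
  have hψ' : Integrable fun y : EuclideanSpace ℝ (Fin 2) =>
      fderiv ℝ u (toLp 2 ![y 0, y 1, c]) (EuclideanSpace.single j 1) j :=
    integrable_plane_of_norm_le_rpow (g := fun x => fderiv ℝ u x (EuclideanSpace.single j 1) j)
      ((EuclideanSpace.proj j).continuous.comp (hDcont.clm_apply continuous_const))
      (by norm_num : (2 : ℝ) < 3)
      (fun x => ((norm_apply_le_norm _ j).trans (norm_fderiv_single_le u x j)).trans (h1 x)) c
  refine integral_eq_zero_of_hasLineDerivAt v hψ hψ' fun y => ?_
  show HasDerivAt (fun t : ℝ => u (toLp 2 ![(y + t • v : EuclideanSpace ℝ (Fin 2)) 0,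
    (y + t • v : EuclideanSpace ℝ (Fin 2)) 1, c]) j) _ 0
  simp_rw [hv]
  have hline : HasDerivAt (fun t : ℝ => (toLp 2 ![y 0, y 1, c] : EuclideanSpace ℝ (Fin 3)) +
      t • EuclideanSpace.single j 1) (EuclideanSpace.single j 1) 0 := by
    simpa using ((hasDerivAt_id (0 : ℝ)).smul_const (EuclideanSpace.single j (1 : ℝ))).const_add
      (toLp 2 ![y 0, y 1, c] : EuclideanSpace ℝ (Fin 3))
  have h2 := ((hdiff _).hasFDerivAt).comp_hasDerivAt (0 : ℝ) hline
  have h3 := ((EuclideanSpace.proj j : EuclideanSpace ℝ (Fin 3) →L[ℝ] ℝ).hasFDerivAt).comp_hasDerivAt (0 : ℝ) h2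
  simpa [Function.comp_def] using h3

/-- **The derivative of the planar flux vanishes** for a divergence-free field:
`∫ (∂₂u)₂ = −∫ ((∂₀u)₀ + (∂₁u)₁) = 0`. -/
theorem integral_plane_fderiv_apply_two_eq_zero (hu : ContDiff ℝ 1 u) (hdiv : VectorCalculus.IsDivFree u)
    (h0 : ∀ x, ‖u x‖ ≤ C * (1 + ‖x‖) ^ (-(3 : ℝ))) (h1 : ∀ x, ‖fderiv ℝ u x‖ ≤ C * (1 + ‖x‖) ^ (-(3 : ℝ)))
    (c : ℝ) :
    ∫ y : EuclideanSpace ℝ (Fin 2), fderiv ℝ u (toLp 2 ![y 0, y 1, c]) (EuclideanSpace.single 2 1) 2 = 0 := by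
  have hDcont : Continuous (fderiv ℝ u) := hu.continuous_fderiv one_ne_zero
  -- pointwise: `(∂₂u)₂ = −(∂₀u)₀ − (∂₁u)₁`
  have hpt : ∀ x, fderiv ℝ u x (EuclideanSpace.single 2 1) 2 =
      -(fderiv ℝ u x (EuclideanSpace.single 0 1) 0) - fderiv ℝ u x (EuclideanSpace.single 1 1) 1 := by
    intro x
    have h := hdiv x
    rw [divergence_eq_sum_fderiv_apply u x, Fin.sum_univ_three] at h
    linarith
  have hI : ∀ j : Fin 3, Integrable fun y : EuclideanSpace ℝ (Fin 2) =>
      fderiv ℝ u (toLp 2 ![y 0, y 1, c]) (EuclideanSpace.single j 1) j := fun j =>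
    integrable_plane_of_norm_le_rpow (g := fun x => fderiv ℝ u x (EuclideanSpace.single j 1) j)
      ((EuclideanSpace.proj j).continuous.comp (hDcont.clm_apply continuous_const))
      (by norm_num : (2 : ℝ) < 3)
      (fun x => ((norm_apply_le_norm _ j).trans (norm_fderiv_single_le u x j)).trans (h1 x)) c
  have h0' := integral_plane_fderiv_apply_inplane_eq_zero hu h0 h1 c (j := 0)
    (v := EuclideanSpace.single 0 1) (fun y t => toLp_vec3_add_smul_single_zero y c t)
  have h1' := integral_plane_fderiv_apply_inplane_eq_zero hu h0 h1 c (j := 1)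
    (v := EuclideanSpace.single 1 1) (fun y t => toLp_vec3_add_smul_single_one y c t)
  simp_rw [hpt]
  rw [integral_sub, integral_neg, h0', h1']
  · simp
  · exact (hI 0).neg
  · exact hI 1

/-- **The planar flux vanishes at infinity**: `∫ u₂(y₀,y₁,c) dy → 0` as `c → +∞` (dominated
convergence: `‖u(y₀,y₁,c)‖ ≤ C(1+|c|)⁻³`, majorant `C(1+‖y‖)⁻³`). -/
theorem tendsto_planarFlux_atTop (hu : Continuous u) (h0 : ∀ x, ‖u x‖ ≤ C * (1 + ‖x‖) ^ (-(3 : ℝ))) :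
    Tendsto (fun c : ℝ => ∫ y : EuclideanSpace ℝ (Fin 2), u (toLp 2 ![y 0, y 1, c]) 2) atTop (𝓝 0) := by
  have hC : 0 ≤ C := by
    have := h0 0
    have hw : 0 < (1 + ‖(0 : EuclideanSpace ℝ (Fin 3))‖) ^ (-(3 : ℝ)) := Real.rpow_pos_of_pos (by positivity) _
    nlinarith [norm_nonneg (u 0)]
  have hr' : (Module.finrank ℝ (EuclideanSpace ℝ (Fin 2)) : ℝ) < 3 := by
    rw [finrank_euclideanSpace, Fintype.card_fin]; norm_num
  have hbound_int : Integrable fun y : EuclideanSpace ℝ (Fin 2) => C * (1 + ‖y‖) ^ (-(3 : ℝ)) :=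
    (integrable_one_add_norm hr').const_mul C
  rw [← integral_zero]
  refine tendsto_integral_filter_of_dominated_convergence (fun y => C * (1 + ‖y‖) ^ (-(3 : ℝ))) ?_ ?_
    hbound_int ?_
  · exact Eventually.of_forall fun c =>
      ((EuclideanSpace.proj (2 : Fin 3)).continuous.comp (hu.comp (continuous_toLp_vec3_left c))).aestronglyMeasurable
  · refine Eventually.of_forall fun c => ae_of_all _ fun y => ?_
    calc ‖u (toLp 2 ![y 0, y 1, c]) 2‖ ≤ ‖u (toLp 2 ![y 0, y 1, c])‖ := norm_apply_le_norm _ 2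
      _ ≤ C * (1 + ‖(toLp 2 ![y 0, y 1, c] : EuclideanSpace ℝ (Fin 3))‖) ^ (-(3 : ℝ)) := h0 _
      _ ≤ C * (1 + ‖y‖) ^ (-(3 : ℝ)) := by
          gcongr C * ?_
          exact Real.rpow_le_rpow_of_nonpos (by positivity) (by linarith [norm_le_norm_toLp_vec3 y c]) (by norm_num)
  · refine ae_of_all _ fun y => ?_
    -- pointwise decay along the normal line
    have hle : ∀ c : ℝ, ‖u (toLp 2 ![y 0, y 1, c]) 2‖ ≤ C * (1 + |c|) ^ (-(3 : ℝ)) := fun c =>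
      calc ‖u (toLp 2 ![y 0, y 1, c]) 2‖ ≤ ‖u (toLp 2 ![y 0, y 1, c])‖ := norm_apply_le_norm _ 2
        _ ≤ C * (1 + ‖(toLp 2 ![y 0, y 1, c] : EuclideanSpace ℝ (Fin 3))‖) ^ (-(3 : ℝ)) := h0 _
        _ ≤ C * (1 + |c|) ^ (-(3 : ℝ)) := by
            gcongr C * ?_
            exact Real.rpow_le_rpow_of_nonpos (by positivity) (by linarith [abs_le_norm_toLp_vec3 y c]) (by norm_num)
    have hlim : Tendsto (fun c : ℝ => C * (1 + |c|) ^ (-(3 : ℝ))) atTop (𝓝 0) := by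
      have h1 : Tendsto (fun c : ℝ => 1 + |c|) atTop atTop :=
        tendsto_atTop_add_const_left _ 1 (tendsto_abs_atTop_atTop)
      have h2 : Tendsto (fun c : ℝ => (1 + |c|) ^ (-(3 : ℝ))) atTop (𝓝 0) :=
        (tendsto_rpow_neg_atTop (by norm_num : (0 : ℝ) < 3)).comp h1
      simpa using h2.const_mul C
    exact squeeze_zero_norm hle hlim

/-- **No net flux through a coordinate plane.** For a `C¹` divergence-free field `u` on `ℝ³` with
`‖u‖, ‖Du‖ ≤ C(1+‖x‖)⁻³`: `∫_{ℝ²} u₂(y₀,y₁,c) dy = 0` for every `c` (the flux is constant in `c`,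
having zero derivative, and tends to `0` at `+∞`). [folklore] -/
theorem integral_plane_apply_two_eq_zero (hu : ContDiff ℝ 1 u) (hdiv : VectorCalculus.IsDivFree u)
    (h0 : ∀ x, ‖u x‖ ≤ C * (1 + ‖x‖) ^ (-(3 : ℝ))) (h1 : ∀ x, ‖fderiv ℝ u x‖ ≤ C * (1 + ‖x‖) ^ (-(3 : ℝ)))
    (c : ℝ) : ∫ y : EuclideanSpace ℝ (Fin 2), u (toLp 2 ![y 0, y 1, c]) 2 = 0 := by
  set Q : ℝ → ℝ := fun c => ∫ y : EuclideanSpace ℝ (Fin 2), u (toLp 2 ![y 0, y 1, c]) 2 with hQ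
  have hderiv : ∀ c, HasDerivAt Q 0 c := fun c => by
    have h := hasDerivAt_planarFlux hu h0 h1 c
    rwa [integral_plane_fderiv_apply_two_eq_zero hu hdiv h0 h1 c] at h
  have hconst : ∀ a b, Q a = Q b :=
    is_const_of_deriv_eq_zero (fun c => (hderiv c).differentiableAt) fun c => (hderiv c).deriv
  have hlim : Tendsto Q atTop (𝓝 0) := tendsto_planarFlux_atTop hu.continuous h0
  have hQc : Tendsto (fun _ : ℝ => Q c) atTop (𝓝 0) := hlim.congr fun b => hconst b c
  exact tendsto_nhds_unique tendsto_const_nhds hQc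

end Flux

/-! ### Every plane: rotated statement -/

/-- **No net flux through any plane.** For a `C¹` divergence-free field `u` on `ℝ³` with
`‖u‖, ‖Du‖ ≤ C(1+‖x‖)⁻³`, the flux through every plane `R({x₂ = c})` (`R` a linear isometry)
vanishes: `∫_{ℝ²} ⟪u(R(y₀,y₁,c)), R e₂⟫ dy = 0`. (Apply the coordinate statement to the conjugate
field `R⁻¹ ∘ u ∘ R`, which is `C¹`, divergence free and has the same decay.) [folklore] -/
theorem integral_plane_inner_isometry_eq_zero {u : EuclideanSpace ℝ (Fin 3) → EuclideanSpace ℝ (Fin 3)} {C : ℝ}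
    (hu : ContDiff ℝ 1 u) (hdiv : VectorCalculus.IsDivFree u)
    (h0 : ∀ x, ‖u x‖ ≤ C * (1 + ‖x‖) ^ (-(3 : ℝ))) (h1 : ∀ x, ‖fderiv ℝ u x‖ ≤ C * (1 + ‖x‖) ^ (-(3 : ℝ)))
    (R : EuclideanSpace ℝ (Fin 3) ≃ₗᵢ[ℝ] EuclideanSpace ℝ (Fin 3)) (c : ℝ) :
    ∫ y : EuclideanSpace ℝ (Fin 2), ⟪u (R (toLp 2 ![y 0, y 1, c])), R (EuclideanSpace.single 2 1)⟫ = 0 := by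
  -- the conjugate field `v = R⁻¹ ∘ u ∘ R`
  set v : EuclideanSpace ℝ (Fin 3) → EuclideanSpace ℝ (Fin 3) := fun x => R.symm (u (R.symm.symm x)) with hv
  have hvu : ∀ x, v x = R.symm (u (R x)) := fun x => by simp [hv]
  have hv1 : ContDiff ℝ 1 v := by
    rw [hv]
    exact R.symm.contDiff.comp (hu.comp R.symm.symm.contDiff)
  have hvdiv : VectorCalculus.IsDivFree v := hdiv.conj_linearIsometryEquiv (R := R.symm)
  have hv0 : ∀ x, ‖v x‖ ≤ C * (1 + ‖x‖) ^ (-(3 : ℝ)) := fun x => by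
    rw [hvu, LinearIsometryEquiv.norm_map]
    simpa [LinearIsometryEquiv.norm_map] using h0 (R x)
  have hvD : ∀ x, ‖fderiv ℝ v x‖ ≤ C * (1 + ‖x‖) ^ (-(3 : ℝ)) := fun x => by
    rw [hv, fderiv_conj_linearIsometryEquiv]
    rw [ContinuousLinearMap.opNorm_linearIsometryEquiv_comp, ContinuousLinearMap.opNorm_comp_linearIsometryEquiv]
    simpa [LinearIsometryEquiv.norm_map] using h1 (R x)
  have key := integral_plane_apply_two_eq_zero hv1 hvdiv hv0 hvD c
  rw [← key]
  refine integral_congr_ae (ae_of_all _ fun y => ?_)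
  dsimp only
  rw [hvu]
  -- `(R⁻¹ w)₂ = ⟪R⁻¹ w, e₂⟫ = ⟪w, R e₂⟫`
  have : (R.symm (u (R (toLp 2 ![y 0, y 1, c])))) 2 =
      ⟪R.symm (u (R (toLp 2 ![y 0, y 1, c]))), EuclideanSpace.single 2 1⟫ := by
    simp [EuclideanSpace.inner_single_right]
  rw [this]
  conv_rhs => rw [← LinearIsometryEquiv.inner_map_map R, LinearIsometryEquiv.apply_symm_apply]

/-- **No net flux through any plane, registered form** (sub-goal `planarFlux_eq_zero` of
stmt-NavierStokesRegularity-16855): for a `C¹` divergence-free field on `ℝ³` with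
`‖u‖, ‖Du‖ ≤ C(1+‖x‖)⁻³`, `∫_{ℝ²} ⟪u(R(y₀,y₁,c)), R e₂⟫ dy = 0` for every linear isometry `R` and
every offset `c`. [folklore] -/
theorem planarFlux_eq_zero : ∀ (u : EuclideanSpace ℝ (Fin 3) → EuclideanSpace ℝ (Fin 3)) (C : ℝ), ContDiff ℝ 1 u → Literature.Analysis.FluidPDE.VectorCalculus.IsDivFree u → (∀ x, ‖u x‖ ≤ C * (1 + ‖x‖) ^ (-(3 : ℝ))) → (∀ x, ‖fderiv ℝ u x‖ ≤ C * (1 + ‖x‖) ^ (-(3 : ℝ))) → ∀ (R : EuclideanSpace ℝ (Fin 3) ≃ₗᵢ[ℝ] EuclideanSpace ℝ (Fin 3)) (c : ℝ), ∫ y : EuclideanSpace ℝ (Fin 2), inner ℝ (u (R (WithLp.toLp 2 ![y 0, y 1, c]))) (R (EuclideanSpace.single 2 1)) = 0 :=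
  fun _ _ hu hdiv h0 h1 R c => integral_plane_inner_isometry_eq_zero hu hdiv h0 h1 R c

end Summit.NavierStokesRegularity.NavierStokesRegularity.Theorems.PlanarEnergyAPriori

end
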